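import Summits.QuantumFields.YangMills.Theorems.UnitScaleTiltProp7CovCombMeanCentred
import Literature.MathematicalPhysics.QuantumFieldTheory.Balaban1983to89.B12B0LoopGeometry267
import HarnessLib

/-!
# Route `UnitScaleTilt`, crux K1 «MinimiserStabilityRegPr» (stmt-QuantumFields-19200), route-R [RP] curved, row (n3) N3b 2d (i) «CM-osc ℓ¹» (★p1 g13 HAND
# 2026-08-28 14:03Z) — THE `ℓ¹` OSCILLATION ROW OF THE COVARIANT COMB MEAN: `Σ_z‖CM_V X(z)‖ ≤ c₁·Σ_{b,ν}‖V(b₋,ν)X(b+e_ν)V(b₋,ν)* − X(b)‖ + c₂(a)·Σ_b‖X(b)‖`,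
# `c₁ = (d+2)L·d(L−1)/2`, `c₂(a) = (d+2)L·(d(L−1) + 2)·((dL)²/4)·a` at a background with plaquette variables within `a` of `1`

Cell `ym3-torus`, keyed width hand `ym-routeR-w2` (gen 2; the (R-B) lineage of `Prop7CovCombMeanCentred`).  THEOREMS ONLY (0 `def`, 0 `sorry`); `--supports stmt-QuantumFields-19200`,
count-neutral.  YM₃ on T³ is a ladder rung (R3), not the Clay problem; nothing here claims a stub, the crux, d = 4 or the gap.

WHY.  ★routeR-w6 g3's two-channel damped engine (`Prop7TrueLinSourcedOscL1.sum_norm_sourced_le_osc`, N3b file 2d) displays the one-level row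
`hCM : Σ_z‖CM_jZ(z)‖ ≤ c₁·osc j Z + c₂·w j·Σ_b‖Z b‖` — the covariant comb mean of [Balaban1987RG1] (0.3)–(0.4) kills direction constants, so its `ℓ¹` norm is an
OSCILLATION of the field plus a small-field leak.  The SUP form of that fact is in the tree (`Prop7CovCombMeanCentred.norm_covCombMean_le_osc`: per block,
`‖CM(z)‖ ≤ (d+2)L·(o + 2θB)` for frame-read direction constants `m`, oscillation `o`, frame defect `θ`, field bound `B`; `frame_defect_stair_le`: `θ = ((dL)²/4)·a` for the
canonical staircase frame).  This file is its `ℓ¹` corollary with `osc` = the covariant-gradient `ℓ¹` sum of `Prop7TrueLinSourcedDefect.sum_normSq_covGrad_le_mass`'s summand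
(★p1 g13's located steps (a)–(c)): per block take `B_z = Σ_{b₋∈B(z)}‖X b‖`, `m_z(κ) =` the frame-read value at the centre's `κ`-bond, and bound the frame-read oscillation of
every in-block bond by TELESCOPING along the canonical staircase from the centre (≤ `d(L−1)/2` steps, each step = one adjacent same-direction pair: frame-read difference
≤ covariant difference + `2θ·‖X‖` by a change of frame around ONE closed word `Γ_{z→y+e_ν} ∪ (−e_ν) ∪ (−Γ_{z→y})` of length `≤ dL`), then sum over the blocks fibrewise.

WHAT IS PROVED (ns `…Theorems.Prop7CovCombMeanOscL1`; any `P`, any rank `n`, level `j` with `j + 1 ≤ m + K`).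
* §1 `off_blockIdx_eq` ∕ `walkEnd_stairWord_blockIdx` — block coordinates: a site `y ∈ B(z)` is the end of the canonical staircase `Γ¹_{z→y}` to its centred offset.
* §2 ★ `dist1_frameLoop_le` — the frame defect of ONE lattice step `‖τ_z(y+e_ν)·V(y,ν)*·τ_z(y)* − 1‖ ≤ ((dL)²/4)·a` (closed word of length `≤ dL`, `LatticeWordStokes.dist1_holAt_le`).
* §3 ★ `norm_frameRead_step_le` — ONE STEP: `‖τ(y′)X(y′,κ)τ(y′)* − τ(y)X(y,κ)τ(y)*‖ ≤ ‖V(y,ν)X(y+e_ν,κ)V(y,ν)* − X(y,κ)‖ + 2·((dL)²/4)a·‖X(y,κ)‖`, `y′ = y + e_ν`.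
* §4 ★ `norm_frameRead_sub_centre_le` — TELESCOPING: for an in-block bond `b`, `‖τ(b₋)X(b)τ(b₋)* − m_z(dir b)‖ ≤ (d(L−1)/2)·(OSC_z + 2θ·M_z)`,
  `OSC_z = Σ_{b₋∈B(z)}Σ_ν‖cov. diff.‖`, `M_z = Σ_{b₋∈B(z)}‖X b‖`.
* §5 ★★ `norm_covCombMean_le_osc_mass` (per block) and ★★★ `sum_norm_covCombMean_le_osc` (the title; `hCM` with `c₁ = (d+2)L·d(L−1)/2`, leak `c₂·w = (d+2)L·(d(L−1)+2)·((dL)²/4)·a`).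

HONEST SCOPE.  Bookkeeping and the triangle inequality over the tree's (0.3)∕(0.4) letters and its non-abelian Stokes bound; the path sum is charged crudely (`steps × sup`
instead of distinct pairs — an L-only factor `d(L−1)/2`); nothing of Bałaban's analysis is asserted.  References: T. Bałaban, CMP 95 (1984) 17–40 [Balaban1984PropagatorsI]
((1.18)–(1.20) pp.19–20); CMP 98 (1985) 17–51 [Balaban1985Averaging] ((19)–(20) p.21, (58) p.27, (62) p.28); CMP 109 (1987) 249–301 [Balaban1987RG1] ((0.3)–(0.4) pp.252–253).
-/

set_option autoImplicit false
noncomputable section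

open scoped BigOperators Matrix.Norms.L2Operator

namespace Summit.QuantumFields.YangMills.Theorems.Prop7CovCombMeanOscL1

open Literature.MathematicalPhysics.QuantumFieldTheory.Balaban1983to89
open Finset T4Continuum BlockAveraging AveragingRT BlockAveragingEMLLinearised BlockAveragingEMLLinearisedBackground
open Summit.QuantumFields.YangMills.Theorems.Prop7CovCombMeanCentred
  (norm_conj_sub_conj_le_frame norm_covCombMean_le_osc intOffset_walkEnd_take_stairWord frame_defect_stair_le)
open B12B0LoopGeometry267 (blockOf_walkEnd_take_stairWord)

variable {P : Params} {n : Type*} [Fintype n] [DecidableEq n] [Nonempty n] {j : ℕ}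

/-! ## §1 Block coordinates: a block site is the end of the canonical staircase to its centred offset -/

omit [Fintype n] [DecidableEq n] [Nonempty n] in
/-- The centred offset of a site `y ∈ B(z)` read from its label: `off r(y) = y − emb z` coordinatewise, `r(y)_κ = (label of y)_κ mod L` (standing range: no wrap-around).
[cite: Balaban1987RG1, (0.3) p.252] -/
theorem off_blockIdx_eq (hj : j + 1 ≤ P.m + P.K) {z : Site P (j + 1)} {y : Site P j} (hy : blockOf y = z) (κ : Fin P.d) :
    off (fun κ : Fin P.d => (⟨(y κ).val % P.L, Nat.mod_lt _ P.L_pos⟩ : Fin P.L)) κ = ((y κ).val : ℤ) - (((emb z) κ).val : ℤ) := by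
  have h1 : (y κ).val / P.L = (z κ).val := by rw [← Site.val_blockOf hj y κ, hy]
  have h2 : P.L * ((y κ).val / P.L) + (y κ).val % P.L = (y κ).val := Nat.div_add_mod _ _
  have h3 : ((emb z) κ).val = (z κ).val * P.L + (P.L - 1) / 2 := Site.val_emb hj z κ
  rw [h1] at h2
  simp only [off]
  push_cast
  have h2' : ((P.L : ℤ) * ((z κ).val : ℤ) + (((y κ).val % P.L : ℕ) : ℤ)) = ((y κ).val : ℤ) := by exact_mod_cast h2
  have h3' : ((((emb z) κ).val : ℕ) : ℤ) = ((z κ).val : ℤ) * (P.L : ℤ) + (((P.L - 1) / 2 : ℕ) : ℤ) := by exact_mod_cast h3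
  rw [h3']
  linarith

omit [Fintype n] [DecidableEq n] [Nonempty n] in
/-- A site given by centred integer offsets `t` from `emb z` (read on labels) is the end of the `σ = 1` staircase `Γ¹` to `t`. [cite: Balaban1987RG1, (0.3) p.252] -/
theorem eq_walkEnd_stairWord_of_intOff (z : Site P (j + 1)) (s : Site P j) (t : Fin P.d → ℤ)
    (hs : ∀ κ, ((s κ).val : ℤ) - (((emb z) κ).val : ℤ) = t κ) : s = walkEnd (emb z) (stairWord 1 t) := by
  funext κ
  rw [walkEnd_apply, netDisp_stairWord, ← hs κ]
  push_cast
  rw [ZMod.natCast_zmod_val, ZMod.natCast_zmod_val]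
  ring

omit [Fintype n] [DecidableEq n] [Nonempty n] in
/-- `y ∈ B(z)` is the end of the canonical staircase from the centre to its centred offset `r(y)`. [cite: Balaban1987RG1, (0.3) p.252] -/
theorem walkEnd_stairWord_blockIdx (hj : j + 1 ≤ P.m + P.K) {z : Site P (j + 1)} {y : Site P j} (hy : blockOf y = z) :
    walkEnd (emb z) (stairWord 1 (off fun κ : Fin P.d => (⟨(y κ).val % P.L, Nat.mod_lt _ P.L_pos⟩ : Fin P.L))) = y :=
  (eq_walkEnd_stairWord_of_intOff z y _ fun κ => (off_blockIdx_eq hj hy κ).symm).symm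

/-! ## §2 The frame defect of one lattice step (non-abelian Stokes around one closed word) -/

/-- ★ **THE FRAME DEFECT OF ONE STEP.**  At a background `V` of `T^{(j)}` with plaquette variables within `a` of `1`, for centred offsets `t` and `t′ = t + e_ν` both in the
standing range `[−(L−1)/2, (L−1)/2]^d` of the block `B(z)`: the canonical frames `τ_z(y) = V(Γ¹_{z→y})` at `y = emb z + t` and `y′ = y + e_ν` differ across the bond `(y, ν)` by
at most `((dL)²/4)·a`: `‖τ_z(y′)·V(y,ν)*·τ_z(y)* − 1‖ ≤ ((dL)²/4)·a` — the product is the holonomy of the CLOSED word `Γ¹_{z→y′} ∪ (−e_ν) ∪ (−Γ¹_{z→y})` of length `≤ d(L−1)+1 ≤ dL`,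
bounded by `LatticeWordStokes.dist1_holAt_le` (strict threshold, then the limit). [cite: Balaban1985Averaging, (19)-(20) p.21; Balaban1987RG1, (0.3) p.252] -/
theorem dist1_frameLoop_le (V : GaugeField P j (Matrix.specialUnitaryGroup n ℂ)) {a : ℝ} (ha : 0 ≤ a)
    (hV : ∀ q : Plaq P j, dist1 (GaugeField.plaqHol V q) ≤ a) (z : Site P (j + 1)) (ν : Fin P.d) (t t' : Fin P.d → ℤ)
    (htt' : ∀ κ, t' κ = t κ + if κ = ν then 1 else 0)
    (ht : ∀ κ, -(((P.L - 1) / 2 : ℕ) : ℤ) ≤ t κ ∧ t κ ≤ (((P.L - 1) / 2 : ℕ) : ℤ))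
    (ht' : ∀ κ, -(((P.L - 1) / 2 : ℕ) : ℤ) ≤ t' κ ∧ t' κ ≤ (((P.L - 1) / 2 : ℕ) : ℤ)) :
    ‖((holAt V (walk (emb z) (stairWord 1 t')) : Matrix.specialUnitaryGroup n ℂ) : Matrix n n ℂ)
        * star ((V ⟨walkEnd (emb z) (stairWord 1 t), ν⟩ : Matrix.specialUnitaryGroup n ℂ) : Matrix n n ℂ)
        * star ((holAt V (walk (emb z) (stairWord 1 t)) : Matrix.specialUnitaryGroup n ℂ) : Matrix n n ℂ) - 1‖
      ≤ ((((P.d * P.L : ℕ) : ℝ)) ^ 2 / 4) * a := by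
  set s : Site P j := walkEnd (emb z) (stairWord 1 t) with hs
  -- the closed word
  set w : List (Letter P.d) := stairWord 1 t' ++ ((ν, false) :: wordRev (stairWord 1 t)) with hw
  have hend' : walkEnd (emb z) (stairWord 1 t') = s.shift ν := by
    funext κ
    rw [walkEnd_apply, netDisp_stairWord, htt', Site.shift_apply, hs, walkEnd_apply, walkEnd_apply, netDisp_stairWord, netDisp_stairWord]
    by_cases hκ : κ = ν
    · subst hκ; simp only [if_true]; push_cast; ring
    · simp only [if_neg hκ]; push_cast; ring
  have hwalk : walk (emb z) w = walk (emb z) (stairWord 1 t') ++ (⟨⟨s, ν⟩, false⟩ :: walk s (wordRev (stairWord 1 t))) := by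
    rw [hw, walk_append, hend']
    show _ ++ (⟨⟨(s.shift ν).unshift ν, ν⟩, false⟩ :: walk ((s.shift ν).unshift ν) (wordRev (stairWord 1 t))) = _
    rw [T4ReflectionCone.shift_unshift]
  have hinvcoe : ∀ g : Matrix.specialUnitaryGroup n ℂ, (((g⁻¹ : Matrix.specialUnitaryGroup n ℂ)) : Matrix n n ℂ) = star (g : Matrix n n ℂ) :=
    fun _ => rfl
  have hhol : holAt V (walk (emb z) w)
      = holAt V (walk (emb z) (stairWord 1 t')) * ((V ⟨s, ν⟩)⁻¹ * (holAt V (walk (emb z) (stairWord 1 t)))⁻¹) := by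
    rw [hwalk, holAt_append, holAt_cons]
    simp only [Bool.false_eq_true, ↓reduceIte]
    rw [hs, holAt_walk_wordRev]
  have hmat : ((holAt V (walk (emb z) w) : Matrix.specialUnitaryGroup n ℂ) : Matrix n n ℂ)
      = ((holAt V (walk (emb z) (stairWord 1 t')) : Matrix.specialUnitaryGroup n ℂ) : Matrix n n ℂ)
        * star ((V ⟨s, ν⟩ : Matrix.specialUnitaryGroup n ℂ) : Matrix n n ℂ)
        * star ((holAt V (walk (emb z) (stairWord 1 t)) : Matrix.specialUnitaryGroup n ℂ) : Matrix n n ℂ) := by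
    rw [hhol, Submonoid.coe_mul, Submonoid.coe_mul, hinvcoe, hinvcoe, Matrix.mul_assoc]
  -- the word is closed and short
  have hclosed : ∀ κ, netDisp w κ = 0 := by
    intro κ
    rw [hw, T4ReflectionCone.netDisp_append, netDisp_cons, netDisp_wordRev, netDisp_stairWord, netDisp_stairWord, htt']
    by_cases hκ : ν = κ
    · subst hκ; simp
    · simp [hκ, Ne.symm hκ]
  have hL := AveragingRT.two_mul_half_add_one P
  have hd : 0 < P.d := Fin.pos ν
  have hlen : w.length ≤ P.d * P.L := by
    have h1 : (stairWord 1 t').length ≤ P.d * ((P.L - 1) / 2) :=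
      LatticeWordStokes.length_stairWord_le 1 t' _ (fun κ => by have := ht' κ; omega)
    have h2 : (wordRev (stairWord 1 t)).length ≤ P.d * ((P.L - 1) / 2) := by
      have : (wordRev (stairWord 1 t)).length = (stairWord 1 t).length := by simp [wordRev]
      rw [this]
      exact LatticeWordStokes.length_stairWord_le 1 t _ (fun κ => by have := ht κ; omega)
    have h3 : P.d * P.L = 2 * (P.d * ((P.L - 1) / 2)) + P.d := by
      conv_lhs => rw [← hL]
      ring
    rw [hw, List.length_append, List.length_cons, h3]
    omega
  have hlenR : (w.length : ℝ) ≤ ((P.d * P.L : ℕ) : ℝ) := by exact_mod_cast hlen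
  -- Stokes with a strict threshold, then the limit
  rw [← hmat, ← FederbushMean.dist1_SU_eq]
  have hK : 0 < (((P.d * P.L : ℕ) : ℝ)) ^ 2 / 4 := by
    have : (0 : ℝ) < ((P.d * P.L : ℕ) : ℝ) := by
      have := P.L_pos
      exact_mod_cast Nat.mul_pos hd this
    positivity
  refine le_of_forall_gt_imp_ge_of_dense fun c hc => ?_
  set δ : ℝ := c / ((((P.d * P.L : ℕ) : ℝ)) ^ 2 / 4) with hδ
  have hδa : a < δ := by
    rw [hδ, lt_div_iff₀ hK]
    linarith
  have hδ0 : 0 ≤ δ := ha.trans hδa.le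
  have h := LatticeWordStokes.dist1_holAt_le V hδ0 (fun q => (hV q).trans_lt hδa) w hclosed (emb z)
  have h0 : (0 : ℝ) ≤ (w.length : ℝ) := Nat.cast_nonneg _
  calc dist1 (holAt V (walk (emb z) w)) ≤ ((w.length : ℝ) ^ 2 / 4) * δ := h
    _ ≤ ((((P.d * P.L : ℕ) : ℝ)) ^ 2 / 4) * δ := by
        refine mul_le_mul_of_nonneg_right ?_ hδ0
        have := mul_le_mul hlenR hlenR h0 (h0.trans hlenR)
        nlinarith
    _ = c := by
        have hK' : (((P.d * P.L : ℕ) : ℝ)) ^ 2 / 4 ≠ 0 := ne_of_gt hK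
        rw [hδ, mul_comm, div_mul_cancel₀ c hK']

/-! ## §3 One step of the frame-read oscillation: covariant difference plus the frame defect -/

/-- ★ **ONE STEP.**  For block sites `s = emb z + t` and `s′ = s + e_ν = emb z + t′` (centred offsets in the standing range, read on labels), a direction `κ` and a bond field
`X`: the frame-read values of `X` at the `κ`-bonds of `s′` and `s` differ by at most the COVARIANT `ν`-difference at `(s, κ)` plus `2·((dL)²/4)a·‖X(s,κ)‖`:
`τ′X′τ′* − τXτ* = (τ′V*)·(VX′V* − X)·(τ′V*)* + [(τ′V*)·X·(τ′V*)* − τ·X·τ*]`, the first term is isometric, the second is a change of frame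
(`Prop7CovCombMeanCentred.norm_conj_sub_conj_le_frame`) across the one-step loop of §2. [cite: Balaban1985Averaging, (58) p.27, (19)-(20) p.21] -/
theorem norm_frameRead_step_le (V : GaugeField P j (Matrix.specialUnitaryGroup n ℂ)) {a : ℝ} (ha : 0 ≤ a)
    (hV : ∀ q : Plaq P j, dist1 (GaugeField.plaqHol V q) ≤ a) (z : Site P (j + 1)) (ν κ : Fin P.d) (t t' : Fin P.d → ℤ)
    (htt' : ∀ κ', t' κ' = t κ' + if κ' = ν then 1 else 0)
    (ht : ∀ κ', -(((P.L - 1) / 2 : ℕ) : ℤ) ≤ t κ' ∧ t κ' ≤ (((P.L - 1) / 2 : ℕ) : ℤ))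
    (ht' : ∀ κ', -(((P.L - 1) / 2 : ℕ) : ℤ) ≤ t' κ' ∧ t' κ' ≤ (((P.L - 1) / 2 : ℕ) : ℤ))
    {s s' : Site P j} (hss' : s' = s.shift ν)
    (hs : ∀ κ', ((s κ').val : ℤ) - (((emb z) κ').val : ℤ) = t κ') (hs' : ∀ κ', ((s' κ').val : ℤ) - (((emb z) κ').val : ℤ) = t' κ')
    (X : PBond P j → Matrix n n ℂ) :
    ‖((holAt V (walk (emb z) (stairWord 1 fun κ' => ((s' κ').val : ℤ) - (((emb z) κ').val : ℤ))) : Matrix.specialUnitaryGroup n ℂ) : Matrix n n ℂ) * X ⟨s', κ⟩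
          * star ((holAt V (walk (emb z) (stairWord 1 fun κ' => ((s' κ').val : ℤ) - (((emb z) κ').val : ℤ))) : Matrix.specialUnitaryGroup n ℂ) : Matrix n n ℂ)
        - ((holAt V (walk (emb z) (stairWord 1 fun κ' => ((s κ').val : ℤ) - (((emb z) κ').val : ℤ))) : Matrix.specialUnitaryGroup n ℂ) : Matrix n n ℂ) * X ⟨s, κ⟩
          * star ((holAt V (walk (emb z) (stairWord 1 fun κ' => ((s κ').val : ℤ) - (((emb z) κ').val : ℤ))) : Matrix.specialUnitaryGroup n ℂ) : Matrix n n ℂ)‖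
      ≤ ‖((V ⟨s, ν⟩ : Matrix.specialUnitaryGroup n ℂ) : Matrix n n ℂ) * X ⟨s.shift ν, κ⟩ * star ((V ⟨s, ν⟩ : Matrix.specialUnitaryGroup n ℂ) : Matrix n n ℂ) - X ⟨s, κ⟩‖
        + 2 * (((((P.d * P.L : ℕ) : ℝ)) ^ 2 / 4) * a) * ‖X ⟨s, κ⟩‖ := by
  have hts : (fun κ' => ((s κ').val : ℤ) - (((emb z) κ').val : ℤ)) = t := funext hs
  have hts' : (fun κ' => ((s' κ').val : ℤ) - (((emb z) κ').val : ℤ)) = t' := funext hs'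
  rw [hts, hts', hss']
  have hsw : s = walkEnd (emb z) (stairWord 1 t) := eq_walkEnd_stairWord_of_intOff z s t hs
  -- letters
  set τ₀ : Matrix.specialUnitaryGroup n ℂ := holAt V (walk (emb z) (stairWord 1 t)) with hτ₀
  set τ₁ : Matrix.specialUnitaryGroup n ℂ := holAt V (walk (emb z) (stairWord 1 t')) with hτ₁
  set W : Matrix.specialUnitaryGroup n ℂ := V ⟨s, ν⟩ with hW
  set g : Matrix.specialUnitaryGroup n ℂ := τ₁ * W⁻¹ with hg
  have hgcoe : ((g : Matrix.specialUnitaryGroup n ℂ) : Matrix n n ℂ) = (τ₁ : Matrix n n ℂ) * star (W : Matrix n n ℂ) := by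
    rw [hg, Submonoid.coe_mul]; rfl
  have hWW : star ((W : Matrix.specialUnitaryGroup n ℂ) : Matrix n n ℂ) * (W : Matrix n n ℂ) = 1 :=
    Matrix.mem_unitaryGroup_iff'.mp W.2.1
  set Xb : Matrix n n ℂ := X ⟨s, κ⟩
  set Xb' : Matrix n n ℂ := X ⟨s.shift ν, κ⟩
  -- the algebraic split
  have hsplit : (τ₁ : Matrix n n ℂ) * Xb' * star (τ₁ : Matrix n n ℂ) - (τ₀ : Matrix n n ℂ) * Xb * star (τ₀ : Matrix n n ℂ)
      = (g : Matrix n n ℂ) * ((W : Matrix n n ℂ) * Xb' * star (W : Matrix n n ℂ) - Xb) * star (g : Matrix n n ℂ)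
        + ((g : Matrix n n ℂ) * Xb * star (g : Matrix n n ℂ) - (τ₀ : Matrix n n ℂ) * Xb * star (τ₀ : Matrix n n ℂ)) := by
    rw [hgcoe, star_mul, star_star]
    have e1 : (τ₁ : Matrix n n ℂ) * star (W : Matrix n n ℂ) * ((W : Matrix n n ℂ) * Xb' * star (W : Matrix n n ℂ) - Xb)
          * ((W : Matrix n n ℂ) * star (τ₁ : Matrix n n ℂ))
        = (τ₁ : Matrix n n ℂ) * (star (W : Matrix n n ℂ) * (W : Matrix n n ℂ)) * Xb' * (star (W : Matrix n n ℂ) * (W : Matrix n n ℂ)) * star (τ₁ : Matrix n n ℂ)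
          - (τ₁ : Matrix n n ℂ) * star (W : Matrix n n ℂ) * Xb * ((W : Matrix n n ℂ) * star (τ₁ : Matrix n n ℂ)) := by
      noncomm_ring
    rw [e1, hWW, Matrix.mul_one, Matrix.mul_one]
    noncomm_ring
  rw [hsplit]
  refine (norm_add_le _ _).trans (add_le_add ?_ ?_)
  · -- isometric conjugation
    have hgU : ((g : Matrix.specialUnitaryGroup n ℂ) : Matrix n n ℂ) ∈ unitary (Matrix n n ℂ) := Matrix.specialUnitaryGroup_le_unitaryGroup g.2
    rw [CStarRing.norm_mul_mem_unitary _ (Unitary.star_mem hgU), CStarRing.norm_mem_unitary_mul _ hgU]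
  · -- change of frame across the one-step loop
    have hfr := norm_conj_sub_conj_le_frame g τ₀ Xb
    have hloop : ‖((g : Matrix.specialUnitaryGroup n ℂ) : Matrix n n ℂ) * star ((τ₀ : Matrix.specialUnitaryGroup n ℂ) : Matrix n n ℂ) - 1‖
        ≤ ((((P.d * P.L : ℕ) : ℝ)) ^ 2 / 4) * a := by
      rw [hgcoe, hW, hsw]
      exact dist1_frameLoop_le V ha hV z ν t t' htt' ht ht'
    calc _ ≤ 2 * ‖((g : Matrix.specialUnitaryGroup n ℂ) : Matrix n n ℂ) * star ((τ₀ : Matrix.specialUnitaryGroup n ℂ) : Matrix n n ℂ) - 1‖ * ‖Xb‖ := hfr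
      _ ≤ 2 * (((((P.d * P.L : ℕ) : ℝ)) ^ 2 / 4) * a) * ‖Xb‖ :=
          mul_le_mul_of_nonneg_right (mul_le_mul_of_nonneg_left hloop (by norm_num)) (norm_nonneg _)

/-! ## §4 Telescoping along the canonical staircase: the frame-read oscillation of an in-block bond -/
/-- ★ **TELESCOPING.**  For a bond `b` issuing from the block `B(z)` (`b₋ ∈ B(z)`), the frame-read value of `X b` (canonical staircase frame at `b₋`) differs from the
frame-read value at the centre's bond of the same direction by at most `d(L−1)/2` (the number of steps of the canonical staircase from `emb z` to `b₋`) times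
`OSC_z + 2·((dL)²/4)a·M_z` (`OSC_z` = the covariant-gradient `ℓ¹` sum over the bonds issuing from `B(z)`, `M_z` their mass): each step of the staircase is §3 at a site of
`B(z)` (`B12B0LoopGeometry267.blockOf_walkEnd_take_stairWord`), charged crudely by the whole block sums. [cite: Balaban1987RG1, (0.3) p.252; Balaban1985Averaging, (58) p.27] -/
theorem norm_frameRead_sub_centre_le (hj : j + 1 ≤ P.m + P.K) (V : GaugeField P j (Matrix.specialUnitaryGroup n ℂ)) {a : ℝ} (ha : 0 ≤ a)
    (hV : ∀ q : Plaq P j, dist1 (GaugeField.plaqHol V q) ≤ a) (X : PBond P j → Matrix n n ℂ) (z : Site P (j + 1))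
    (b : PBond P j) (hb₁ : blockOf b.src = z) :
    ‖((holAt V (walk (emb z) (stairWord 1 fun κ' => ((b.src κ').val : ℤ) - (((emb z) κ').val : ℤ))) : Matrix.specialUnitaryGroup n ℂ) : Matrix n n ℂ) * X b
          * star ((holAt V (walk (emb z) (stairWord 1 fun κ' => ((b.src κ').val : ℤ) - (((emb z) κ').val : ℤ))) : Matrix.specialUnitaryGroup n ℂ) : Matrix n n ℂ)
        - ((holAt V (walk (emb z) (stairWord 1 fun κ' => (((emb z) κ').val : ℤ) - (((emb z) κ').val : ℤ))) : Matrix.specialUnitaryGroup n ℂ) : Matrix n n ℂ) * X ⟨emb z, b.dir⟩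
          * star ((holAt V (walk (emb z) (stairWord 1 fun κ' => (((emb z) κ').val : ℤ) - (((emb z) κ').val : ℤ))) : Matrix.specialUnitaryGroup n ℂ) : Matrix n n ℂ)‖
      ≤ ((P.d * ((P.L - 1) / 2) : ℕ) : ℝ) *
        ((∑ b' ∈ univ.filter (fun b' : PBond P j => blockOf b'.src = z), ∑ ν : Fin P.d, ‖((V ⟨b'.src, ν⟩ : Matrix.specialUnitaryGroup n ℂ) : Matrix n n ℂ) * X ⟨b'.src.shift ν, b'.dir⟩ * star ((V ⟨b'.src, ν⟩ : Matrix.specialUnitaryGroup n ℂ) : Matrix n n ℂ) - X b'‖)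
          + 2 * (((((P.d * P.L : ℕ) : ℝ)) ^ 2 / 4) * a) * ∑ b' ∈ univ.filter (fun b' : PBond P j => blockOf b'.src = z), ‖X b'‖) := by
  classical
  set θ : ℝ := ((((P.d * P.L : ℕ) : ℝ)) ^ 2 / 4) * a with hθ
  set S : Finset (PBond P j) := univ.filter (fun b' : PBond P j => blockOf b'.src = z) with hS
  set OSC : ℝ := ∑ b' ∈ S, ∑ ν : Fin P.d, ‖((V ⟨b'.src, ν⟩ : Matrix.specialUnitaryGroup n ℂ) : Matrix n n ℂ) * X ⟨b'.src.shift ν, b'.dir⟩ * star ((V ⟨b'.src, ν⟩ : Matrix.specialUnitaryGroup n ℂ) : Matrix n n ℂ) - X b'‖ with hOSC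
  set Mz : ℝ := ∑ b' ∈ S, ‖X b'‖ with hMz
  have hθ0 : 0 ≤ θ := by positivity
  have hOSC0 : 0 ≤ OSC := Finset.sum_nonneg fun _ _ => Finset.sum_nonneg fun _ _ => norm_nonneg _
  have hMz0 : 0 ≤ Mz := Finset.sum_nonneg fun _ _ => norm_nonneg _
  -- single terms of the block sums
  have hmemOSC : ∀ (x : Site P j) (κ' ν : Fin P.d), blockOf x = z →
      ‖((V ⟨x, ν⟩ : Matrix.specialUnitaryGroup n ℂ) : Matrix n n ℂ) * X ⟨(x).shift ν, κ'⟩ * star ((V ⟨x, ν⟩ : Matrix.specialUnitaryGroup n ℂ) : Matrix n n ℂ) - X ⟨x, κ'⟩‖ ≤ OSC := by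
    intro x κ' ν hx
    have hmem : (⟨x, κ'⟩ : PBond P j) ∈ S := Finset.mem_filter.mpr ⟨Finset.mem_univ _, hx⟩
    have h1 := Finset.single_le_sum (s := S) (f := fun b' : PBond P j => ∑ ν : Fin P.d, ‖((V ⟨b'.src, ν⟩ : Matrix.specialUnitaryGroup n ℂ) : Matrix n n ℂ) * X ⟨b'.src.shift ν, b'.dir⟩ * star ((V ⟨b'.src, ν⟩ : Matrix.specialUnitaryGroup n ℂ) : Matrix n n ℂ) - X b'‖)
      (fun _ _ => Finset.sum_nonneg fun _ _ => norm_nonneg _) hmem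
    have h2 := Finset.single_le_sum (s := (Finset.univ : Finset (Fin P.d)))
      (f := fun ν' : Fin P.d => ‖((V ⟨x, ν'⟩ : Matrix.specialUnitaryGroup n ℂ) : Matrix n n ℂ) * X ⟨(x).shift ν', κ'⟩ * star ((V ⟨x, ν'⟩ : Matrix.specialUnitaryGroup n ℂ) : Matrix n n ℂ) - X ⟨x, κ'⟩‖) (fun _ _ => norm_nonneg _) (Finset.mem_univ ν)
    exact h2.trans h1
  have hmemM : ∀ (x : Site P j) (κ' : Fin P.d), blockOf x = z → ‖X ⟨x, κ'⟩‖ ≤ Mz := fun x κ' hx =>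
    Finset.single_le_sum (s := S) (f := fun b' : PBond P j => ‖X b'‖) (fun _ _ => norm_nonneg _) (Finset.mem_filter.mpr ⟨Finset.mem_univ _, hx⟩)
  -- the canonical staircase of `y = b₋`
  set y : Site P j := b.src with hy
  set κ : Fin P.d := b.dir with hκ
  have hbeta : (⟨y, κ⟩ : PBond P j) = b := by rw [hy, hκ]
  set r : Fin P.d → Fin P.L := fun κ' => ⟨(y κ').val % P.L, Nat.mod_lt _ P.L_pos⟩ with hr
  set w : List (Letter P.d) := stairWord (1 : Equiv.Perm (Fin P.d)) (off r) with hw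
  have hL := AveragingRT.two_mul_half_add_one P
  have hst : ∀ (i : ℕ) (κ' : Fin P.d), (((walkEnd (emb z) (w.take i)) κ').val : ℤ) - (((emb z) κ').val : ℤ) = netDisp (w.take i) κ' :=
    fun i κ' => intOffset_walkEnd_take_stairWord hj z 1 r i κ'
  have htb : ∀ (i : ℕ) (κ' : Fin P.d),
      -(((P.L - 1) / 2 : ℕ) : ℤ) ≤ netDisp (w.take i) κ' ∧ netDisp (w.take i) κ' ≤ (((P.L - 1) / 2 : ℕ) : ℤ) := by
    intro i κ'
    have h1 := netDisp_take_stairWord (1 : Equiv.Perm (Fin P.d)) (off r) κ' i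
    have h2 := off_bounds r κ'
    constructor
    · exact le_trans (le_min (by omega) h2.1) h1.1
    · exact le_trans h1.2 (max_le (by omega) h2.2)
  have hblk : ∀ i : ℕ, blockOf (walkEnd (emb z) (w.take i)) = z := fun i => blockOf_walkEnd_take_stairWord hj z 1 r i
  have hy_end : walkEnd (emb z) w = y := walkEnd_stairWord_blockIdx hj hb₁
  have hp : w.length ≤ P.d * ((P.L - 1) / 2) :=
    LatticeWordStokes.length_stairWord_le 1 (off r) _ (fun κ' => by have := off_bounds r κ'; omega)
  -- the frame-read values along the staircase
  set F : ℕ → Matrix n n ℂ := fun i =>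
    ((holAt V (walk (emb z) (stairWord 1 fun κ' => (((walkEnd (emb z) (w.take i)) κ').val : ℤ) - (((emb z) κ').val : ℤ))) : Matrix.specialUnitaryGroup n ℂ) : Matrix n n ℂ)
      * X ⟨walkEnd (emb z) (w.take i), κ⟩
      * star ((holAt V (walk (emb z) (stairWord 1 fun κ' => (((walkEnd (emb z) (w.take i)) κ').val : ℤ) - (((emb z) κ').val : ℤ))) : Matrix.specialUnitaryGroup n ℂ) : Matrix n n ℂ) with hF
  have hFi : ∀ i, F i = ((holAt V (walk (emb z) (stairWord 1 fun κ' => (((walkEnd (emb z) (w.take i)) κ').val : ℤ) - (((emb z) κ').val : ℤ))) : Matrix.specialUnitaryGroup n ℂ) : Matrix n n ℂ)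
      * X ⟨walkEnd (emb z) (w.take i), κ⟩
      * star ((holAt V (walk (emb z) (stairWord 1 fun κ' => (((walkEnd (emb z) (w.take i)) κ').val : ℤ) - (((emb z) κ').val : ℤ))) : Matrix.specialUnitaryGroup n ℂ) : Matrix n n ℂ) := fun i => by rw [hF]
  have hstep : ∀ i < w.length, ‖F (i + 1) - F i‖ ≤ OSC + 2 * θ * Mz := by
    intro i hi
    have htake : w.take (i + 1) = w.take i ++ [w[i]] := by
      rw [List.take_add_one, List.getElem?_eq_getElem hi]; rfl
    rcases hwi : w[i] with ⟨μ, bb⟩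
    have hti : ∀ κ', netDisp (w.take (i + 1)) κ' = netDisp (w.take i) κ' + (if μ = κ' then (if bb then (1 : ℤ) else -1) else 0) := by
      intro κ'
      rw [htake, hwi, T4ReflectionCone.netDisp_append, netDisp_cons, netDisp_nil']
      ring
    have hsucc : walkEnd (emb z) (w.take (i + 1)) = walkEnd (walkEnd (emb z) (w.take i)) [(μ, bb)] := by
      rw [htake, hwi, walkEnd_append]
    rw [hFi, hFi]
    cases bb with
    | true =>
      have hss' : walkEnd (emb z) (w.take (i + 1)) = (walkEnd (emb z) (w.take i)).shift μ := by rw [hsucc]; rfl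
      have hA := norm_frameRead_step_le V ha hV z μ κ (fun κ' => netDisp (w.take i) κ') (fun κ' => netDisp (w.take (i + 1)) κ')
        (fun κ' => by
          rw [hti κ']
          by_cases h : κ' = μ
          · subst h; simp
          · simp [h, Ne.symm h]) (htb i) (htb (i + 1)) hss' (hst i) (hst (i + 1)) X
      refine hA.trans (add_le_add (hmemOSC _ κ μ (hblk i)) ?_)
      exact mul_le_mul_of_nonneg_left (hmemM _ κ (hblk i)) (by positivity)
    | false =>
      have hss' : walkEnd (emb z) (w.take i) = (walkEnd (emb z) (w.take (i + 1))).shift μ := by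
        rw [hsucc]
        show _ = ((walkEnd (emb z) (w.take i)).unshift μ).shift μ
        rw [B10StarCount.shift_unshift]
      have hA := norm_frameRead_step_le V ha hV z μ κ (fun κ' => netDisp (w.take (i + 1)) κ') (fun κ' => netDisp (w.take i) κ')
        (fun κ' => by
          rw [hti κ']
          by_cases h : κ' = μ
          · subst h; simp
          · simp [h, Ne.symm h]) (htb (i + 1)) (htb i) hss' (hst (i + 1)) (hst i) X
      rw [norm_sub_rev]
      refine hA.trans (add_le_add (hmemOSC _ κ μ (hblk (i + 1))) ?_)
      exact mul_le_mul_of_nonneg_left (hmemM _ κ (hblk (i + 1))) (by positivity)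
  -- telescoping
  have hF0 : F 0 = ((holAt V (walk (emb z) (stairWord 1 fun κ' => (((emb z) κ').val : ℤ) - (((emb z) κ').val : ℤ))) : Matrix.specialUnitaryGroup n ℂ) : Matrix n n ℂ) * X ⟨emb z, κ⟩
      * star ((holAt V (walk (emb z) (stairWord 1 fun κ' => (((emb z) κ').val : ℤ) - (((emb z) κ').val : ℤ))) : Matrix.specialUnitaryGroup n ℂ) : Matrix n n ℂ) := by
    rw [hFi, List.take_zero]; rfl
  have hFp : F w.length = ((holAt V (walk (emb z) (stairWord 1 fun κ' => ((y κ').val : ℤ) - (((emb z) κ').val : ℤ))) : Matrix.specialUnitaryGroup n ℂ) : Matrix n n ℂ) * X b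
      * star ((holAt V (walk (emb z) (stairWord 1 fun κ' => ((y κ').val : ℤ) - (((emb z) κ').val : ℤ))) : Matrix.specialUnitaryGroup n ℂ) : Matrix n n ℂ) := by
    rw [hFi, List.take_length, hy_end, hbeta]
  have hT0 : 0 ≤ OSC + 2 * θ * Mz := by positivity
  calc _ = ‖F w.length - F 0‖ := by rw [hFp, hF0]
    _ = ‖∑ i ∈ Finset.range w.length, (F (i + 1) - F i)‖ := by rw [Finset.sum_range_sub]
    _ ≤ ∑ i ∈ Finset.range w.length, ‖F (i + 1) - F i‖ := norm_sum_le _ _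
    _ ≤ ∑ i ∈ Finset.range w.length, (OSC + 2 * θ * Mz) := Finset.sum_le_sum fun i hi => hstep i (Finset.mem_range.mp hi)
    _ = (w.length : ℝ) * (OSC + 2 * θ * Mz) := by rw [Finset.sum_const, Finset.card_range, nsmul_eq_mul]
    _ ≤ ((P.d * ((P.L - 1) / 2) : ℕ) : ℝ) * (OSC + 2 * θ * Mz) := mul_le_mul_of_nonneg_right (by exact_mod_cast hp) hT0

/-! ## §5 The `ℓ¹` oscillation row of the covariant comb mean -/
/-- ★★ **PER BLOCK**: `‖CM_V X(z)‖ ≤ (d+2)L·( (d(L−1)/2)·(OSC_z + 2θ·M_z) + 2θ·M_z )`, `θ = ((dL)²/4)·a` — `Prop7CovCombMeanCentred.norm_covCombMean_le_osc` with the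
canonical staircase frame (`frame_defect_stair_le`), the frame-read values at the centre's bonds as the direction constants, the block mass as the field bound, and §4 as the
oscillation bound. [cite: Balaban1985Averaging, (58) p.27, (62) p.28; Balaban1987RG1, (0.3)-(0.4) pp.252-253] -/
theorem norm_covCombMean_le_osc_mass (hj : j + 1 ≤ P.m + P.K) (V : GaugeField P j (Matrix.specialUnitaryGroup n ℂ)) {a : ℝ} (ha : 0 ≤ a)
    (hV : ∀ q : Plaq P j, dist1 (GaugeField.plaqHol V q) ≤ a) (X : PBond P j → Matrix n n ℂ) (z : Site P (j + 1)) :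
    ‖((Fintype.card (Idx P) : ℂ))⁻¹ • ∑ i : Idx P, covWalkSum V X (walk (emb z) (stairWord i.2.1 (off i.1)))‖
      ≤ (((P.d + 2) * P.L : ℕ) : ℝ) *
        (((P.d * ((P.L - 1) / 2) : ℕ) : ℝ) * ((∑ b' ∈ univ.filter (fun b' : PBond P j => blockOf b'.src = z), ∑ ν : Fin P.d, ‖((V ⟨b'.src, ν⟩ : Matrix.specialUnitaryGroup n ℂ) : Matrix n n ℂ) * X ⟨b'.src.shift ν, b'.dir⟩ * star ((V ⟨b'.src, ν⟩ : Matrix.specialUnitaryGroup n ℂ) : Matrix n n ℂ) - X b'‖) + 2 * (((((P.d * P.L : ℕ) : ℝ)) ^ 2 / 4) * a) * ∑ b' ∈ univ.filter (fun b' : PBond P j => blockOf b'.src = z), ‖X b'‖)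
          + 2 * (((((P.d * P.L : ℕ) : ℝ)) ^ 2 / 4) * a) * ∑ b' ∈ univ.filter (fun b' : PBond P j => blockOf b'.src = z), ‖X b'‖) := by
  classical
  have hθ0 : 0 ≤ ((((P.d * P.L : ℕ) : ℝ)) ^ 2 / 4) * a := by positivity
  have hM0 : 0 ≤ ∑ b' ∈ univ.filter (fun b' : PBond P j => blockOf b'.src = z), ‖X b'‖ := Finset.sum_nonneg fun _ _ => norm_nonneg _
  have hO0 : 0 ≤ ∑ b' ∈ univ.filter (fun b' : PBond P j => blockOf b'.src = z), ∑ ν : Fin P.d, ‖((V ⟨b'.src, ν⟩ : Matrix.specialUnitaryGroup n ℂ) : Matrix n n ℂ) * X ⟨b'.src.shift ν, b'.dir⟩ * star ((V ⟨b'.src, ν⟩ : Matrix.specialUnitaryGroup n ℂ) : Matrix n n ℂ) - X b'‖ := Finset.sum_nonneg fun _ _ => Finset.sum_nonneg fun _ _ => norm_nonneg _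
  have ho0 : 0 ≤ ((P.d * ((P.L - 1) / 2) : ℕ) : ℝ) * ((∑ b' ∈ univ.filter (fun b' : PBond P j => blockOf b'.src = z), ∑ ν : Fin P.d, ‖((V ⟨b'.src, ν⟩ : Matrix.specialUnitaryGroup n ℂ) : Matrix n n ℂ) * X ⟨b'.src.shift ν, b'.dir⟩ * star ((V ⟨b'.src, ν⟩ : Matrix.specialUnitaryGroup n ℂ) : Matrix n n ℂ) - X b'‖) + 2 * (((((P.d * P.L : ℕ) : ℝ)) ^ 2 / 4) * a) * ∑ b' ∈ univ.filter (fun b' : PBond P j => blockOf b'.src = z), ‖X b'‖) := by positivity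
  exact norm_covCombMean_le_osc hj V X (fun κ => ((holAt V (walk (emb z) (stairWord 1 fun κ' => (((emb z) κ').val : ℤ) - (((emb z) κ').val : ℤ))) : Matrix.specialUnitaryGroup n ℂ) : Matrix n n ℂ) * X ⟨emb z, κ⟩ * star ((holAt V (walk (emb z) (stairWord 1 fun κ' => (((emb z) κ').val : ℤ) - (((emb z) κ').val : ℤ))) : Matrix.specialUnitaryGroup n ℂ) : Matrix n n ℂ)) z
    (fun y : Site P j => holAt V (walk (emb z) (stairWord 1 fun κ' => ((y κ').val : ℤ) - (((emb z) κ').val : ℤ)))) ho0 hθ0 hM0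
    (fun b hb₁ _ => Finset.single_le_sum (s := univ.filter (fun b' : PBond P j => blockOf b'.src = z)) (f := fun b' : PBond P j => ‖X b'‖)
      (fun _ _ => norm_nonneg _) (Finset.mem_filter.mpr ⟨Finset.mem_univ _, hb₁⟩))
    (fun b hb₁ _ => norm_frameRead_sub_centre_le hj V ha hV X z b hb₁)
    (fun σ r p _ => frame_defect_stair_le hj V ha hV z σ r p)

/-- ★★★ **THE `ℓ¹` OSCILLATION ROW OF THE COVARIANT COMB MEAN** (★routeR-w6 g3's `hCM` with `osc` = the covariant-gradient `ℓ¹` sum):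
`Σ_z‖CM_V X(z)‖ ≤ (d+2)L·(d(L−1)/2)·Σ_bΣ_ν‖V(b₋,ν)X(b+e_ν)V(b₋,ν)* − X(b)‖ + (d+2)L·(d(L−1) + 2)·((dL)²/4)·a·Σ_b‖X(b)‖` at a background with plaquette variables within
`a` of `1` — the blocks partition the fine bonds by their source. [cite: Balaban1984PropagatorsI, (1.18)-(1.20) pp.19-20; Balaban1987RG1, (0.3)-(0.4) pp.252-253] -/
theorem sum_norm_covCombMean_le_osc (hj : j + 1 ≤ P.m + P.K) (V : GaugeField P j (Matrix.specialUnitaryGroup n ℂ)) {a : ℝ} (ha : 0 ≤ a)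
    (hV : ∀ q : Plaq P j, dist1 (GaugeField.plaqHol V q) ≤ a) (X : PBond P j → Matrix n n ℂ) :
    ∑ z : Site P (j + 1), ‖((Fintype.card (Idx P) : ℂ))⁻¹ • ∑ i : Idx P, covWalkSum V X (walk (emb z) (stairWord i.2.1 (off i.1)))‖
      ≤ (((P.d + 2) * P.L : ℕ) : ℝ) * ((P.d * ((P.L - 1) / 2) : ℕ) : ℝ)
          * ∑ b : PBond P j, ∑ ν : Fin P.d, ‖((V ⟨b.src, ν⟩ : Matrix.specialUnitaryGroup n ℂ) : Matrix n n ℂ) * X ⟨b.src.shift ν, b.dir⟩ * star ((V ⟨b.src, ν⟩ : Matrix.specialUnitaryGroup n ℂ) : Matrix n n ℂ) - X b‖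
        + (((P.d + 2) * P.L : ℕ) : ℝ) * (2 * ((P.d * ((P.L - 1) / 2) : ℕ) : ℝ) + 2) * (((((P.d * P.L : ℕ) : ℝ)) ^ 2 / 4) * a) * ∑ b : PBond P j, ‖X b‖ := by
  classical
  have hfib1 : ∑ z : Site P (j + 1), ∑ b' ∈ univ.filter (fun b' : PBond P j => blockOf b'.src = z), ∑ ν : Fin P.d, ‖((V ⟨b'.src, ν⟩ : Matrix.specialUnitaryGroup n ℂ) : Matrix n n ℂ) * X ⟨b'.src.shift ν, b'.dir⟩ * star ((V ⟨b'.src, ν⟩ : Matrix.specialUnitaryGroup n ℂ) : Matrix n n ℂ) - X b'‖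
      = ∑ b' : PBond P j, ∑ ν : Fin P.d, ‖((V ⟨b'.src, ν⟩ : Matrix.specialUnitaryGroup n ℂ) : Matrix n n ℂ) * X ⟨b'.src.shift ν, b'.dir⟩ * star ((V ⟨b'.src, ν⟩ : Matrix.specialUnitaryGroup n ℂ) : Matrix n n ℂ) - X b'‖ :=
    Finset.sum_fiberwise_of_maps_to (s := Finset.univ) (t := Finset.univ) (g := fun b' : PBond P j => blockOf b'.src)
      (fun _ _ => Finset.mem_univ _) (fun b' : PBond P j => ∑ ν : Fin P.d, ‖((V ⟨b'.src, ν⟩ : Matrix.specialUnitaryGroup n ℂ) : Matrix n n ℂ) * X ⟨b'.src.shift ν, b'.dir⟩ * star ((V ⟨b'.src, ν⟩ : Matrix.specialUnitaryGroup n ℂ) : Matrix n n ℂ) - X b'‖)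
  have hfib2 : ∑ z : Site P (j + 1), ∑ b' ∈ univ.filter (fun b' : PBond P j => blockOf b'.src = z), ‖X b'‖ = ∑ b' : PBond P j, ‖X b'‖ :=
    Finset.sum_fiberwise_of_maps_to (s := Finset.univ) (t := Finset.univ) (g := fun b' : PBond P j => blockOf b'.src)
      (fun _ _ => Finset.mem_univ _) (fun b' : PBond P j => ‖X b'‖)
  calc _ ≤ ∑ z : Site P (j + 1), (((P.d + 2) * P.L : ℕ) : ℝ) *
        (((P.d * ((P.L - 1) / 2) : ℕ) : ℝ) * ((∑ b' ∈ univ.filter (fun b' : PBond P j => blockOf b'.src = z), ∑ ν : Fin P.d, ‖((V ⟨b'.src, ν⟩ : Matrix.specialUnitaryGroup n ℂ) : Matrix n n ℂ) * X ⟨b'.src.shift ν, b'.dir⟩ * star ((V ⟨b'.src, ν⟩ : Matrix.specialUnitaryGroup n ℂ) : Matrix n n ℂ) - X b'‖) + 2 * (((((P.d * P.L : ℕ) : ℝ)) ^ 2 / 4) * a) * ∑ b' ∈ univ.filter (fun b' : PBond P j => blockOf b'.src = z), ‖X b'‖)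
          + 2 * (((((P.d * P.L : ℕ) : ℝ)) ^ 2 / 4) * a) * ∑ b' ∈ univ.filter (fun b' : PBond P j => blockOf b'.src = z), ‖X b'‖) := Finset.sum_le_sum fun z _ => norm_covCombMean_le_osc_mass hj V ha hV X z
    _ = (((P.d + 2) * P.L : ℕ) : ℝ) * ((P.d * ((P.L - 1) / 2) : ℕ) : ℝ) * ∑ z : Site P (j + 1), ∑ b' ∈ univ.filter (fun b' : PBond P j => blockOf b'.src = z), ∑ ν : Fin P.d, ‖((V ⟨b'.src, ν⟩ : Matrix.specialUnitaryGroup n ℂ) : Matrix n n ℂ) * X ⟨b'.src.shift ν, b'.dir⟩ * star ((V ⟨b'.src, ν⟩ : Matrix.specialUnitaryGroup n ℂ) : Matrix n n ℂ) - X b'‖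
        + (((P.d + 2) * P.L : ℕ) : ℝ) * (2 * ((P.d * ((P.L - 1) / 2) : ℕ) : ℝ) + 2) * (((((P.d * P.L : ℕ) : ℝ)) ^ 2 / 4) * a) * ∑ z : Site P (j + 1), ∑ b' ∈ univ.filter (fun b' : PBond P j => blockOf b'.src = z), ‖X b'‖ := by
        rw [Finset.mul_sum, Finset.mul_sum, ← Finset.sum_add_distrib]
        exact Finset.sum_congr rfl fun z _ => by ring
    _ = _ := by rw [hfib1, hfib2]

end Summit.QuantumFields.YangMills.Theorems.Prop7CovCombMeanOscL1

end
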